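import Summits.FinalStateConjecture.FinalStateConjecture.Theses.EIHFluxBalance
import Summits.FinalStateConjecture.FinalStateConjecture.Theorems.EIHFluxBalanceModulatedKerrHandoffRetardedClock
import Summits.FinalStateConjecture.FinalStateConjecture.Theorems.EIHFluxBalanceModulatedKerrHandoffOneHoleMatching
import Summits.FinalStateConjecture.FinalStateConjecture.Theorems.EIHFluxBalanceModulatedKerrHandoffProfileAssembly
import Summits.FinalStateConjecture.FinalStateConjecture.Theorems.EIHFluxBalanceModulatedKerrHandoffDeviationTransfer

/-!
# Reduction of the crux `EIHFluxBalance.ModulatedKerrHandoff` to the retarded tame handoff (line `photon-rocket-modulation`)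

Crux stmt-FinalStateConjecture-10167, route EIHFluxBalance. This file is the KERNEL-CHECKED TRANSFER `C⁺ ⇒ crux` of the line
`photon-rocket-modulation` (lead `prover-line-stmt-FinalStateConjecture-10167-0`, 2026-08-16): the crux's instantaneous
modulated multi-Kerr–Schild handoff follows from the RETARDED-CLOCK TAME HANDOFF (the registered open-core stub
`stub_retardedTameHandoff`, whose statement is the hypothesis `h₁` below, verbatim) by

* `stub_retardedClock` (retarded time of a subluminal world-line: unique, smooth off the world-line),
* `stub_oneHoleMatching` (one hole: the retarded and the instantaneous boosted Kerr–Schild summands differ by `→ 0` in `C³`,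
  unweighted off the core and `(1 + d^{7/4})`-weighted on the cone, given aligned TAME moduli and the monopole mass rate),
* `stub_profileAssembly` (`N` holes: sum the one-hole conclusions),
* `stub_deviationTransfer` (abstract transfer of the two deviation clauses between reference fields on one chart domain),

all landed in `Theorems/EIHFluxBalanceModulatedKerrHandoff*.lean`, composed by monotonicity of Christodoulou genericity in the
property. What remains of the crux after this file is exactly the hypothesis `h₁`: generic weak cosmic censorship + capture into
a receding multi-Kerr configuration with TAME (hyperbolically receding) aligned moduli and masses drifting at the monopole rate —
the conceded open core of the final state conjecture in retarded currency (Dafermos–Luk arXiv:1710.01722 §1.2.1; Marchal–Saari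
1976 for the parabolic wall the tameness clause excludes generically).

Maintenance note (fullbuild repair 2026-08-17; no mathematics added or changed). The crux this reduction serves was
RESTATED at route rev 6 (2026-08-16T23:18Z, after the summit re-type p126844): stmt-FinalStateConjecture-10167 →
stmt-FinalStateConjecture-17402, under the SAME decl name `Theses.EIHFluxBalance.ModulatedKerrHandoff`, now with TAME
genericity `IsTameChristodoulouGeneric` and four more handoff clauses (T), (O), (R), (QS). The transfer below lands in
plain `IsChristodoulouGeneric` genericity with the twelve-clause instantaneous block of stmt-10167; it does not produce
the rev-6 statement (tame witnesses and (R)/(QS) are not consequences of `h₁`), so against the live decl its last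
`refine` stopped type-checking (full build 2026-08-17). Theorems files being append-only, the statement it DOES prove is
kept exact: the retired crux is recorded below as `ModulatedKerrHandoff10167 : Prop` with its LEDGER SIGNATURE VERBATIM
(the text the route file rendered as the decl's body until rev 6), the transfer is re-keyed to it under the new name
`modulatedKerrHandoff10167_of_retardedTameHandoff` with its proof text unchanged, and the landed name
`modulatedKerrHandoff_of_retardedTameHandoff` survives as a deprecated alias (pattern of
`Theorems/DissipativeFinalMotionsAssembly.lean`, `Theorems/CollisionIsometryCLTAdaptedWeightCLTStatements.lean`).
What it means for the live crux stmt-17402: `h₁` still yields the rev-5 handoff block verbatim; the upgrade to tame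
genericity and the clauses (T) (already in `h₁`'s block: lab-time causal exhaustion), (O), (R), (QS) is the open
remainder. Nothing is asserted: the record is a `Prop` definition used only as the conclusion of the transfer.
-/

noncomputable section

open scoped Manifold ContDiff Topology ENNReal
open Filter Set TopologicalSpace Literature.Geometry.Lorentzian

namespace Summit.FinalStateConjecture.FinalStateConjecture.Cruxes.ModulatedKerrHandoff.PhotonRocketModulation

/-- Christodoulou genericity is monotone in the property (the exceptional set shrinks; the same one-parameter families work).
Christodoulou, CQG 16 (1999) A23, p. A24; this is also the glue of the route's `closes`. -/
theorem reduction_isChristodoulouGeneric_mono {X : Type} [TopologicalSpace X] [ChartedSpace E3 X]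
    [IsManifold (𝓡 3) ((⊤ : ℕ∞) : WithTop ℕ∞) X]
    {𝓓 : Set (InitialDataSet (𝓡 3) X)} {P Q : InitialDataSet (𝓡 3) X → Prop} {m : ℕ}
    (hPQ : ∀ d ∈ 𝓓, P d → Q d) (hP : InitialDataSet.IsChristodoulouGeneric 𝓓 P m) :
    InitialDataSet.IsChristodoulouGeneric 𝓓 Q m := by
  intro d hd
  obtain ⟨F, hF, h0, hinj, hD, hgood⟩ := hP d ⟨hd.1, fun hp ↦ hd.2 (hPQ d hd.1 hp)⟩
  exact ⟨F, hF, h0, hinj, hD, fun c hc hmem ↦ hgood c hc ⟨hmem.1, fun hp ↦ hmem.2 (hPQ _ hmem.1 hp)⟩⟩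

/-- **Record of the retired crux `EIHFluxBalance.ModulatedKerrHandoff`, stmt-FinalStateConjecture-10167** (route
EIHFluxBalance revs 0–5; restated at rev 6 as stmt-17402 under the same decl name; ledger signature VERBATIM, i.e. the text
the route file rendered as the decl body until 2026-08-16T23:18Z): for every connected Hausdorff second-countable
`3`-manifold `X`, Christodoulou-generically (plain `IsChristodoulouGeneric`, codimension `1`) in `admissibleVacuumData X` an
MGHD exists and every MGHD has complete `𝓘⁺` and is asymptotic, in one lab chart `Φ` on the pinned late region, to the
INSTANTANEOUS modulated multi-Kerr–Schild profile of `N` sub-extremal holes with smooth boosts `|γᵢ| ≤ γ`, separating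
centres inside the cone `κ²t`, `C³` deviation `→ 0` on the slabs and `(1 + d^{7/4})`-weighted on `|x̲| ≤ κt`,
`O = exteriorOf 𝒟 (Φ(late exterior))` causally exhausted at every lab time. Recorded here only as the conclusion of the
transfer `modulatedKerrHandoff10167_of_retardedTameHandoff`; the live crux (stmt-17402) strengthens it by tame genericity
and the clauses (O), (R), (QS). A `Prop`, never asserted. -/
def ModulatedKerrHandoff10167 : Prop :=
  open Literature.Geometry.Lorentzian in ∀ (X : Type) [TopologicalSpace X] [ChartedSpace E3 X] [IsManifold (𝓡 3) ((⊤ : ℕ∞) : WithTop ℕ∞) X] [T2Space X] [SecondCountableTopology X] [ConnectedSpace X], InitialDataSet.IsChristodoulouGeneric (admissibleVacuumData X) (fun D ↦ (∃ 𝒟 : VacuumCauchyDevelopment D, 𝒟.IsMaximal) ∧ ∀ 𝒟 : VacuumCauchyDevelopment D, 𝒟.IsMaximal → Summit.FinalStateConjecture.HasCompleteNullInfinity 𝒟.toCauchyDevelopment ∧ (∃ (N : ℕ) (M a rin : Fin N → ℝ) (Λ : Fin N → ℝ → lorentzGroup) (ξ : Fin N → ℝ → E3) (γ κ τ₀ :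 ℝ) (U : Opens E4) (Φ : U → 𝒟.carrier) (O : Set 𝒟.carrier), (∀ i, Kerr.IsSubextremal (M i) (a i) ∧ Kerr.rMinus (M i) (a i) < rin i ∧ rin i < Kerr.rPlus (M i) (a i)) ∧ (∀ i t, |((Λ i t : E4 ≃L[ℝ] E4) (E4.basisVector 0)) 0| ≤ γ) ∧ (∀ i, ContDiff ℝ ((⊤ : ℕ∞) : WithTop ℕ∞) (ξ i) ∧ ContDiff ℝ ((⊤ : ℕ∞) : WithTop ℕ∞) (fun t ↦ ((Λ i t : E4 ≃L[ℝ] E4) : E4 →L[ℝ] E4))) ∧ (∀ i j, i ≠ j → Tendsto (fun t ↦ ‖ξ i t - ξ j t‖) atTop atTop) ∧ (0 < κ ∧ κ < 1 ∧ ∀ i, ∀ᶠ t in atTop, ‖ξ i t‖ ≤ κ ^ 2 * t) ∧ ({x : E4 | τ₀ < x 0 ∧ ∀ i, rin i < Kerr.radius (a i) (poincareInv (Λ i (x 0)) (E4.ofTimeSpace (x 0) (ξ i (x 0))) x)} ⊆ (U : Set E4)) ∧ let B : ModelBackground := ⟨U, fun x ↦ Minkowski.bilin + ∑ i, (boostedKerrBilin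 (Λ i (x 0)) (E4.ofTimeSpace (x 0) (ξ i (x 0))) (M i) (a i) x - Minkowski.bilin), fun x ↦ x 0, E4.spatialNorm⟩; ContMDiff 𝓘(ℝ, E4) (𝓡 4) ((⊤ : ℕ∞) : WithTop ℕ∞) Φ ∧ Topology.IsOpenEmbedding ((B.lateRegion τ₀).restrict Φ) ∧ Φ '' {x : U | τ₀ < x.1 0 ∧ ∀ i, Kerr.rPlus (M i) (a i) < Kerr.radius (a i) (poincareInv (Λ i (x.1 0)) (E4.ofTimeSpace (x.1 0) (ξ i (x.1 0))) x.1)} ⊆ O ∧ Tendsto (fun t ↦ 𝒟.toSpacetime.deviationCk B Φ 3 t) atTop (𝓝 0) ∧ Tendsto (fun t : ℝ ↦ ⨆ x ∈ {x : U | x.1 0 = t ∧ E4.spatialNorm x.1 ≤ κ * t}, ⨆ (m : ℕ) (_ : m ≤ 3), ENNReal.ofReal (1 + √(√((⨅ i, ‖E4.spatial x.1 - ξ i t‖) ^ 7))) * ‖iteratedFDeriv ℝ m (𝒟.toSpacetime.deviationExtend B Φ) x.1‖ₑ) atTop (𝓝 0) ∧ O = Summit.FinalStateConjecture.exteriorOf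 𝒟.toCauchyDevelopment (Φ '' {x : U | τ₀ < x.1 0 ∧ ∀ i, Kerr.rPlus (M i) (a i) < Kerr.radius (a i) (poincareInv (Λ i (x.1 0)) (E4.ofTimeSpace (x.1 0) (ξ i (x.1 0))) x.1)}) ∧ ∀ t₁ : ℝ, τ₀ < t₁ → O \ Φ '' {x : U | t₁ < x.1 0 ∧ ∀ i, Kerr.rPlus (M i) (a i) < Kerr.radius (a i) (poincareInv (Λ i (x.1 0)) (E4.ofTimeSpace (x.1 0) (ξ i (x.1 0))) x.1)} ⊆ 𝒟.metric.causalPast 𝒟.timeOrientation (Φ '' {x : U | x.1 0 = t₁ ∧ ∀ i, Kerr.rPlus (M i) (a i) < Kerr.radius (a i) (poincareInv (Λ i (x.1 0)) (E4.ofTimeSpace (x.1 0) (ξ i (x.1 0))) x.1)}))) 1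

/-- **Reduction `C⁺ ⇒ crux` of the line `photon-rocket-modulation`.** IF, Christodoulou-generically in the admissible class of
every connected Hausdorff second-countable `3`-manifold, an MGHD exists and every MGHD has complete `𝓘⁺` and is asymptotic — in one
lab chart on the pinned late region `{x⁰ > τ₀} ∖ ⋃ᵢ{ρᵢ ≤ rinᵢ}` — to the RETARDED-CLOCK modulated multi-Kerr–Schild profile
`η + Σᵢ (boostedKerrBilin (Λᵢ(Ucᵢx)) (Ucᵢx, ξᵢ(Ucᵢx)) (Mfᵢ(Ucᵢx)) aᵢ x − η)` with smooth ALIGNED future-directed boosts of Lorentz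
factor `≤ γ`, speed `≤ v < 1`, globally bounded and TAME moduli (`u²`-rates after `τ₀`), masses drifting to sub-extremal limits at
the monopole rate `u^{-3/4-σ}`, centres separating inside the cone `κ²t`, clocks solving `x⁰ − Ucᵢx = ‖x̲ − ξᵢ(Ucᵢx)‖`,
deviation `→ 0` unweighted in `C³` on the slabs and `(1 + d^{7/4})`-weighted on `|x̲| ≤ κt`, exterior image in
`O = exteriorOf(…)` and causal exhaustion at every lab time (the hypothesis `h₁`, = registered stub `stub_retardedTameHandoff`
verbatim), THEN the crux `ModulatedKerrHandoff` AS FILED UNTIL ROUTE REV 5 (stmt-10167, recorded verbatim as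
`ModulatedKerrHandoff10167`; fullbuild repair 2026-08-17) holds (same holes, same limit masses and spins, same chart, the
INSTANTANEOUS profile). Proof: monotonicity of genericity; pointwise in the datum and the MGHD, `stub_retardedClock` makes the clocks smooth,
`stub_oneHoleMatching` + `stub_profileAssembly` + `stub_deviationTransfer` move the two deviation clauses from the retarded to the
instantaneous profile, and the remaining clauses are repackaged (`|γᵢ| ≤ γ` from `1 ≤ γᵢ ≤ γ`; the pinned `U` gives the crux's
inclusion; `ρ`, `S` are abbreviations). -/
theorem modulatedKerrHandoff10167_of_retardedTameHandoff :
    (∀ (X : Type) [TopologicalSpace X] [ChartedSpace E3 X] [IsManifold (𝓡 3) ((⊤ : ℕ∞) : WithTop ℕ∞) X] [T2Space X]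
        [SecondCountableTopology X] [ConnectedSpace X],
        InitialDataSet.IsChristodoulouGeneric (admissibleVacuumData X) (fun D ↦
          (∃ 𝒟 : VacuumCauchyDevelopment D, 𝒟.IsMaximal) ∧
          ∀ 𝒟 : VacuumCauchyDevelopment D, 𝒟.IsMaximal →
            Summit.FinalStateConjecture.HasCompleteNullInfinity 𝒟.toCauchyDevelopment ∧
            ∃ (N : ℕ) (M a rin : Fin N → ℝ) (Mf : Fin N → ℝ → ℝ) (Λ : Fin N → ℝ → lorentzGroup) (ξ : Fin N → ℝ → E3) (Uc ρ : Fin N → E4 → ℝ) (v A σ γ κ τ₀ : ℝ) (U : Opens E4) (Φ : U → 𝒟.carrier)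
              (O : Set 𝒟.carrier) (S : ℝ → Set U),
            (∀ i, Kerr.IsSubextremal (M i) (a i) ∧ Kerr.rMinus (M i) (a i) < rin i ∧ rin i < Kerr.rPlus (M i) (a i)) ∧
            (∀ i, ContDiff ℝ ((⊤ : ℕ∞) : WithTop ℕ∞) (ξ i) ∧ ContDiff ℝ ((⊤ : ℕ∞) : WithTop ℕ∞) (fun t ↦ ((Λ i t : E4 ≃L[ℝ] E4) : E4 →L[ℝ] E4)) ∧ ContDiff ℝ ((⊤ : ℕ∞) : WithTop ℕ∞) (Mf i)) ∧
            (0 ≤ v ∧ v < 1 ∧ ∀ i u, ‖deriv (ξ i) u‖ ≤ v) ∧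
            (∀ i u, (Λ i u : E4 ≃L[ℝ] E4) (E4.basisVector 0) = ((Λ i u : E4 ≃L[ℝ] E4) (E4.basisVector 0)) 0 • E4.ofTimeSpace 1 (deriv (ξ i) u) ∧ 1 ≤ ((Λ i u : E4 ≃L[ℝ] E4) (E4.basisVector 0)) 0 ∧ ((Λ i u : E4 ≃L[ℝ] E4) (E4.basisVector 0)) 0 ≤ γ) ∧
            (∀ i u, (∀ k, 1 ≤ k → k ≤ 5 → ‖iteratedDeriv k (ξ i) u‖ ≤ A) ∧ ∀ k ≤ 4, ‖iteratedDeriv k (fun t ↦ ((Λ i t : E4 ≃L[ℝ] E4) : E4 →L[ℝ] E4)) u‖ ≤ A ∧ |iteratedDeriv k (Mf i) u| ≤ A) ∧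
            (0 < τ₀ ∧ 0 < σ ∧ ∀ i u, τ₀ ≤ u → (∀ k, 2 ≤ k → k ≤ 5 → u ^ 2 * ‖iteratedDeriv k (ξ i) u‖ ≤ A) ∧ (∀ k, 1 ≤ k → k ≤ 4 → u ^ 2 * ‖iteratedDeriv k (fun t ↦ ((Λ i t : E4 ≃L[ℝ] E4) : E4 →L[ℝ] E4)) u‖ ≤ A) ∧ ∀ k ≤ 4, u ^ ((3 : ℝ) / 4 + σ) * |iteratedDeriv k (fun s ↦ Mf i s - M i) u| ≤ A) ∧
            (∀ i j, i ≠ j → Tendsto (fun t ↦ ‖ξ i t - ξ j t‖) atTop atTop) ∧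
            (0 < κ ∧ κ < 1 ∧ ∀ i, ∀ᶠ t in atTop, ‖ξ i t‖ ≤ κ ^ 2 * t) ∧
            (∀ i x, x 0 - Uc i x = ‖E4.spatial x - ξ i (Uc i x)‖) ∧
            (∀ i x, ρ i x = Kerr.radius (a i) (poincareInv (Λ i (x 0)) (E4.ofTimeSpace (x 0) (ξ i (x 0))) x)) ∧
            (U : Set E4) = {x : E4 | τ₀ < x 0 ∧ ∀ i, rin i < ρ i x} ∧
            (∀ t₁, S t₁ = {x : U | t₁ < x.1 0 ∧ ∀ i, Kerr.rPlus (M i) (a i) < ρ i x.1}) ∧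
            ContMDiff 𝓘(ℝ, E4) (𝓡 4) ((⊤ : ℕ∞) : WithTop ℕ∞) Φ ∧
            Topology.IsOpenEmbedding (({x : U | τ₀ < x.1 0} : Set U).restrict Φ) ∧
            Φ '' S τ₀ ⊆ O ∧
            Tendsto (fun t ↦ 𝒟.toSpacetime.deviationCk (ModelBackground.mk U (fun x ↦ Minkowski.bilin + ∑ i, (boostedKerrBilin (Λ i (Uc i x)) (E4.ofTimeSpace (Uc i x) (ξ i (Uc i x))) (Mf i (Uc i x)) (a i) x - Minkowski.bilin)) (fun x ↦ x 0) E4.spatialNorm) Φ 3 t) atTop (𝓝 0) ∧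
            Tendsto (fun t : ℝ ↦ ⨆ x ∈ {x : U | x.1 0 = t ∧ E4.spatialNorm x.1 ≤ κ * t}, ⨆ (m : ℕ) (_ : m ≤ 3), ENNReal.ofReal (1 + √(√((⨅ i, ‖E4.spatial x.1 - ξ i t‖) ^ 7))) * ‖iteratedFDeriv ℝ m (𝒟.toSpacetime.deviationExtend (ModelBackground.mk U (fun x ↦ Minkowski.bilin + ∑ i, (boostedKerrBilin (Λ i (Uc i x)) (E4.ofTimeSpace (Uc i x) (ξ i (Uc i x))) (Mf i (Uc i x)) (a i) x - Minkowski.bilin)) (fun x ↦ x 0) E4.spatialNorm) Φ) x.1‖ₑ) atTop (𝓝 0) ∧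
            O = Summit.FinalStateConjecture.exteriorOf 𝒟.toCauchyDevelopment (Φ '' S τ₀) ∧
            ∀ t₁ : ℝ, τ₀ < t₁ → O \ Φ '' S t₁ ⊆ 𝒟.metric.causalPast 𝒟.timeOrientation
              (Φ '' {x : U | x.1 0 = t₁ ∧ ∀ i, Kerr.rPlus (M i) (a i) < ρ i x.1})) 1) →
    ModulatedKerrHandoff10167 := by
  intro h₁
  have h₂ := stub_retardedClock
  have h₃ := stub_oneHoleMatching
  have h₄ := stub_profileAssembly
  have h₅ := stub_deviationTransfer
  intro X _ _ _ _ _ _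
  refine reduction_isChristodoulouGeneric_mono ?_ (h₁ X)
  rintro D - ⟨hex, hall⟩
  refine ⟨hex, fun 𝒟 h𝒟 ↦ ⟨(hall 𝒟 h𝒟).1, ?_⟩⟩
  obtain ⟨N, M, a, rin, Mf, Λ, ξ, Uc, ρ, v, A, σ, γ, κ, τ₀, U, Φ, O, S, hsub, hsm, hv, hal, hgl, htame, hsep,
    hcone, hclk, hρ, hU, hS, hΦ, hemb, hO₁, hdev, hwt, hO₂, hexh⟩ := (hall 𝒟 h𝒟).2
  -- S2: the clocks of S1 are the smooth retarded-time functions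
  have hUc : ∀ i, ContDiffOn ℝ ((⊤ : ℕ∞) : WithTop ℕ∞) (Uc i) {x : E4 | E4.spatial x ≠ ξ i (Uc i x)} := by
    intro i
    obtain ⟨huniq, W, hW, hWs⟩ := h₂ (ξ i) v (hsm i).1 hv.1 hv.2.1 (hv.2.2 i)
    have hUW : Uc i = W := funext fun x ↦ (huniq x).unique (hclk i x) (hW x)
    rw [hUW]
    exact hWs
  -- S3a: one-hole conclusions, hole by hole
  have hO : ∀ i, _ := fun i ↦ h₃ (M i) (a i) (rin i) (Mf i) (Λ i) (ξ i) (Uc i) (ρ i) v A σ γ κ τ₀ (hsub i)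
    (hsm i) ⟨hv.1, hv.2.1, hv.2.2 i⟩ (hal i) (hgl i) ⟨htame.1, htame.2.1, htame.2.2 i⟩
    ⟨hcone.1, hcone.2.1, hcone.2.2 i⟩ (hclk i) (hUc i) (hρ i)
  -- S3c: assemble the N-hole profile facts
  obtain ⟨hP₁, hP₂, hP₃, hP₄⟩ := h₄ N M a rin Mf Λ ξ Uc ρ κ τ₀ U hU hO
  -- S3b: transfer the two deviation clauses to the instantaneous profile
  obtain ⟨hdev', hwt'⟩ := h₅ 𝒟.toSpacetime U Φ
    (fun x ↦ Minkowski.bilin + ∑ i, (boostedKerrBilin (Λ i (Uc i x)) (E4.ofTimeSpace (Uc i x) (ξ i (Uc i x))) (Mf i (Uc i x)) (a i) x - Minkowski.bilin))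
    (fun x ↦ Minkowski.bilin + ∑ i, (boostedKerrBilin (Λ i (x 0)) (E4.ofTimeSpace (x 0) (ξ i (x 0))) (M i) (a i) x - Minkowski.bilin))
    (fun t y ↦ ENNReal.ofReal (1 + √(√((⨅ i, ‖E4.spatial y - ξ i t‖) ^ 7)))) κ hΦ hP₁ hP₂ hP₃ hP₄ hdev hwt
  -- discharge the abbreviations `ρ` (instantaneous-frame Kerr–Schild radii) and `S` (exterior late regions)
  have hρ' : ρ = fun i x ↦ Kerr.radius (a i) (poincareInv (Λ i (x 0)) (E4.ofTimeSpace (x 0) (ξ i (x 0))) x) :=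
    funext fun i ↦ funext (hρ i)
  have hS' : S = fun t₁ ↦ {x : U | t₁ < x.1 0 ∧ ∀ i, Kerr.rPlus (M i) (a i) < ρ i x.1} := funext hS
  subst hS'
  subst hρ'
  refine ⟨N, M, a, rin, Λ, ξ, γ, κ, τ₀, U, Φ, O, hsub, fun i t ↦ ?_, fun i ↦ ⟨(hsm i).1, (hsm i).2.1⟩, hsep,
    hcone, ?_, ?_⟩
  · obtain ⟨-, h1, hγ⟩ := hal i t
    exact (abs_of_pos (lt_of_lt_of_le one_pos h1)).le.trans hγ
  · rw [hU]
  · intro B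
    exact ⟨hΦ, hemb, hO₁, hdev', hwt', hO₂, hexh⟩


/-- Deprecated spelling of `modulatedKerrHandoff10167_of_retardedTameHandoff`: the landed transfer read
`… → Theses.EIHFluxBalance.ModulatedKerrHandoff` against the crux as filed until route rev 5 (stmt-10167); since rev 6
(2026-08-16T23:18Z) that decl name carries the tame restatement stmt-17402, which `h₁` does not yield, so the name now
points at the same proof with the verbatim record `ModulatedKerrHandoff10167` as conclusion (append-only: deprecate, don't
mutate). -/
@[deprecated modulatedKerrHandoff10167_of_retardedTameHandoff (since := "2026-08-17")]
alias modulatedKerrHandoff_of_retardedTameHandoff := modulatedKerrHandoff10167_of_retardedTameHandoff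

end Summit.FinalStateConjecture.FinalStateConjecture.Cruxes.ModulatedKerrHandoff.PhotonRocketModulation

end
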